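import Summits.Ventures.CertifiedQuantumChemistry.Rows.SingletSpinFreeRow
import Summits.Ventures.CertifiedQuantumChemistry.Rows.MaximalSpinProjectionRows
import HarnessLib

/-!
# Ventures/CertifiedQuantumChemistry — Rows/SpinSquaredPenalty.lean: the spin-free tables of `μ Ŝ²`
# and the penalty functional `⟨Ŝ²⟩ = n(2 − n) − ½ Y(Γ)` of the `N = 2n` two-positivity programmes

HONEST FRAMING (verbatim): certified bounds for a stated model Hamiltonian in a stated basis; not a
claim about the real molecule beyond that model.

Seat rdm-B (gen 21), ROWS file: theorems only (no `def`, no notation), zero compute, nothing landed is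
touched; the typer's adopt / refactor / retire word applies. Part 1 of 2 of the typing of
`HOME/STRUCTURE.md` §2.2.1 (ii) — "the scalar row `⟨Ŝ²⟩ = 0` is exactly a free multiplier on that square
(`OPT_DQG+S² = sup_μ OPT_DQG(H + μŜ²)`)"; part 2 (`Rows/SpinSquaredPenaltyDuality.lean`) proves the
`sup` / limit statement, this part sets up the perturbation. Objects (all EXISTING): `rdmEnergy h g h_nuc`
(energy functional of spin-free tables, `VariationalRDMRelaxation`), `IsDQGFeasible N`,
`IsDQGFeasibleSector a b`, `IsDQGFeasibleSinglet n` (the singlet-restricted programme = the cell's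
`DQG+S²` instances, Mazziotti (2007) row (98)), `oneRDM` / `twoRDM`, `spinPlus`, `spinSq`.

THE PERTURBATION. For a multiplier `μ` the tables of `Ĥ + μ Ŝ²` ON THE `N = 2n` SECTOR are
`(h, g − μ·[q = r][p = s], h_nuc + μ·n(2 − n))`: `½ Σ_pqrs (−[q = r][p = s]) e_pqrs = −½ Σ_pq e_pqqp` and
`Ŝ² = −N̂(N̂ − 4)/4 − ½ Σ_pq e_pqqp` (Löwdin's two-matrix form of `⟨Ŝ²⟩`); at pair level the added
functional is `n(2 − n) − ½ Y(Γ)` with rdm-A's spin-summed exchange trace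
`Y(Γ) = Σ_{στ} Σ_{pq} Γ_{(pσ,qτ),(qσ,pτ)}` (`Rows/SingletSpinFreeRow.lean`), whose value `2n(2 − n)` IS the
singlet row (`isDQGFeasibleSinglet_iff_spinFreeRow`).

* §1 `rdmEnergy_spinPenalty` — `E_{h, g−μδ, h_nuc+μc}(γ, Γ) = E_{h,g,h_nuc}(γ, Γ) + μ (c − ½ Y(Γ))` (pure
  bookkeeping), `re_rdmEnergy_spinPenalty` (real `μ`); **`spinPenalty_nonneg`** — `0 ≤ n(2 − n) − ½ Y(Γ)`
  on `IsDQGFeasible (n + n)` (`⟨Ŝ²⟩ ≥ 0` from `G ⪰ 0`: rdm-A's `two_mul_exchangeTrace_le`), with its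
  real / imaginary parts; **`spinPenalty_eq_zero_of_isDQGFeasibleSinglet`** and
  **`isDQGFeasibleSinglet_of_spinPenalty_eq_zero`** — the penalty vanishes EXACTLY on the singlet-feasible
  set; `rdmEnergy_spinPenalty_of_isDQGFeasibleSinglet` (the penalised functional is the plain one there).
* §2 IDENTIFICATION: **`spinPenalty_eq_sum_gMap_of_isDQGFeasibleSector`** — on the `(n, n)` sector
  programme the penalty is the cell's E3 row form `Σ_{pq} G_{(pβ,pα),(qβ,qα)}` (FORMAT-qcl1 §5;
  `= n − Σ_{xy} Γ_{(xα,yβ),(yα,xβ)}`, Mazziotti's row-(98) functional,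
  `spinPenalty_eq_sub_exchange_of_isDQGFeasibleSector`), so "`Ĥ + μŜ²` on the sector instance" = "the
  objective shifted by `μ ×` the instance's own E3 form"; `spinPenalty_rdm_eq_norm_sq_spinPlus`,
  **`spinPenalty_rdm_eq_expect_spinSq`**, **`rdmEnergy_spinPenalty_rdm`** — on the pair of a unit vector
  of the `(n, n)` sector the penalty is `‖Ŝ_+ψ‖² = ⟨ψ|Ŝ²|ψ⟩` (`spinSq`) and the penalised functional is
  `⟨ψ|Ĥ|ψ⟩ + μ⟨ψ|Ŝ²|ψ⟩`: the perturbed tables ARE `Ĥ + μŜ²` on that sector.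

Everything is PROVED (0 sorry, standard axioms); no definitions, no named facts; nothing asserts a bound
about any model; no claim node / hint / row / CERTIFIED cell depends on it. Generator-B independence is
untouched (rdm-A's tree theorems are imported as public mathematics; no generator code or instance file
is read).

References: D. A. Mazziotti, in *Reduced-Density-Matrix Mechanics*, Adv. Chem. Phys. 134 (Wiley 2007)
ch. 3 §II.F.1 eqs. (96)–(98) (`Ŝ² = Ŝ_z + Ŝ_z² + Ŝ_−Ŝ_+`, the `S`-representability row); M. Nakata et al.,
J. Chem. Phys. 128 (2008) 164113 §II.A–C; FORMAT-qcl1 v0.3.0 §5 (E3 row) (`HOME/pub-qchem-rdm/FORMAT-qcl1.md`).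
Tree (REUSED): `rdmEnergy`, `rdmEnergy_rdm`, `gMap_rdm`, `IsDQGFeasible`, `IsDQGFeasibleSector(.of_state)`,
`IsDQGFeasibleSinglet` (typer); `two_mul_exchangeTrace_le`, `exchangeTrace_of_isDQGFeasibleSinglet`,
`isDQGFeasibleSinglet_of_spinFreeRow`, `sum_sum_cross_eq_neg`, `sum_gMap_downUp_of_isDQGFeasibleSector`,
`sum_exchange_downUp_eq` (rdm-A); `sum_particleHoleRDM_eq_norm_spinPlus` (rdm-B);
`LiebTwo.spinSq_mulVec_eq_of_spinZ_zero`, `LiebThm1.spinZ_mulVec_of_isInSector` (QuantumLattice).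
Mathlib: `Complex.nonneg_iff`, `Complex.zero_le_real`, `Finset.sum_ite_eq`, `Finset.sum_comm`.
-/

noncomputable section

namespace Summit.Ventures.CertifiedQuantumChemistry

open Matrix Finset
open Literature.MathematicalPhysics.QuantumLattice Literature.MathematicalPhysics.QuantumChemistry
open scoped ComplexOrder

variable {Λ : Type*} [LinearOrder Λ] [Fintype Λ]

/-! ### §1 The penalty functional `n(2 − n) − ½ Y(Γ)`: bookkeeping, sign, zero set -/

section Penalty

variable (h : Λ → Λ → ℂ) (g : Λ → Λ → Λ → Λ → ℂ) (hnuc : ℂ)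

omit [LinearOrder Λ] in
/-- Moving the two spin sums outside the two orbital sums. -/
private theorem sum_orb_spin_comm (f : Λ → Λ → Fin 2 → Fin 2 → ℂ) :
    ∑ p : Λ, ∑ q : Λ, ∑ σ : Fin 2, ∑ τ : Fin 2, f p q σ τ =
      ∑ σ : Fin 2, ∑ τ : Fin 2, ∑ p : Λ, ∑ q : Λ, f p q σ τ := by
  calc ∑ p : Λ, ∑ q : Λ, ∑ σ : Fin 2, ∑ τ : Fin 2, f p q σ τ
      = ∑ p : Λ, ∑ σ : Fin 2, ∑ q : Λ, ∑ τ : Fin 2, f p q σ τ :=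
        Finset.sum_congr rfl fun p _ => Finset.sum_comm
    _ = ∑ σ : Fin 2, ∑ p : Λ, ∑ q : Λ, ∑ τ : Fin 2, f p q σ τ := Finset.sum_comm
    _ = ∑ σ : Fin 2, ∑ p : Λ, ∑ τ : Fin 2, ∑ q : Λ, f p q σ τ :=
        Finset.sum_congr rfl fun σ _ => Finset.sum_congr rfl fun p _ => Finset.sum_comm
    _ = ∑ σ : Fin 2, ∑ τ : Fin 2, ∑ p : Λ, ∑ q : Λ, f p q σ τ :=
        Finset.sum_congr rfl fun σ _ => Finset.sum_comm

/-- **The penalised energy functional.** Perturbing the two-electron table by `−μ [q = r][p = s]` (the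
table of `−½ Σ_pq e_pqqp`) and the constant by `μ c` adds `μ (c − ½ Y(Γ))` to the energy functional,
`Y(Γ) = Σ_{στ} Σ_{pq} Γ_{(pσ,qτ),(qσ,pτ)}` the spin-summed exchange trace (`Rows/SingletSpinFreeRow`). -/
theorem rdmEnergy_spinPenalty (μ c : ℂ) (γ : Matrix (Orb Λ) (Orb Λ) ℂ)
    (Γ : Matrix (Orb Λ × Orb Λ) (Orb Λ × Orb Λ) ℂ) :
    rdmEnergy h (fun p q r s => g p q r s - μ * (if q = r ∧ p = s then 1 else 0)) (hnuc + μ * c) γ Γ =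
      rdmEnergy h g hnuc γ Γ +
        μ * (c - (1 / 2 : ℂ) * ∑ σ : Fin 2, ∑ τ : Fin 2, ∑ p : Λ, ∑ q : Λ,
          Γ (orb p σ, orb q τ) (orb q σ, orb p τ)) := by
  have key : ∀ p q : Λ, ∑ r : Λ, ∑ s : Λ, μ * (if q = r ∧ p = s then (1 : ℂ) else 0) *
      ∑ σ : Fin 2, ∑ τ : Fin 2, Γ (orb p σ, orb r τ) (orb q σ, orb s τ) =
      μ * ∑ σ : Fin 2, ∑ τ : Fin 2, Γ (orb p σ, orb q τ) (orb q σ, orb p τ) := by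
    intro p q
    simp only [ite_and, mul_ite, ite_mul, mul_one, mul_zero, zero_mul, Finset.sum_ite_irrel,
      Finset.sum_const_zero, Finset.sum_ite_eq, Finset.mem_univ, if_true]
  unfold rdmEnergy
  simp only [sub_mul, Finset.sum_sub_distrib, key, ← Finset.mul_sum]
  rw [sum_orb_spin_comm fun p q σ τ => Γ (orb p σ, orb q τ) (orb q σ, orb p τ)]
  ring

/-- **Real form** of the penalised functional for a real multiplier `μ`:
`Re E_μ = Re E + μ · Re (c − ½ Y)`. -/
theorem re_rdmEnergy_spinPenalty (μ : ℝ) (c : ℂ) (γ : Matrix (Orb Λ) (Orb Λ) ℂ)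
    (Γ : Matrix (Orb Λ × Orb Λ) (Orb Λ × Orb Λ) ℂ) :
    (rdmEnergy h (fun p q r s => g p q r s - (μ : ℂ) * (if q = r ∧ p = s then 1 else 0))
        (hnuc + (μ : ℂ) * c) γ Γ).re =
      (rdmEnergy h g hnuc γ Γ).re +
        μ * (c - (1 / 2 : ℂ) * ∑ σ : Fin 2, ∑ τ : Fin 2, ∑ p : Λ, ∑ q : Λ,
          Γ (orb p σ, orb q τ) (orb q σ, orb p τ)).re := by
  rw [rdmEnergy_spinPenalty, Complex.add_re, Complex.re_ofReal_mul]

variable {n : ℕ} {γ : Matrix (Orb Λ) (Orb Λ) ℂ} {Γ : Matrix (Orb Λ × Orb Λ) (Orb Λ × Orb Λ) ℂ}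

/-- **The penalty is non-negative on the `N = 2n` DQG programme**: `0 ≤ n(2 − n) − ½ Y(Γ)` (in `ℂ`,
i.e. real and non-negative) — `⟨Ŝ²⟩ ≥ 0` follows from `G ⪰ 0` (rdm-A's `two_mul_exchangeTrace_le`:
`2Y ≤ 4N − N²`). -/
theorem spinPenalty_nonneg (hf : IsDQGFeasible (n + n) γ Γ) :
    (0 : ℂ) ≤ (n : ℂ) * (2 - (n : ℂ)) - (1 / 2 : ℂ) * ∑ σ : Fin 2, ∑ τ : Fin 2, ∑ p : Λ, ∑ q : Λ,
      Γ (orb p σ, orb q τ) (orb q σ, orb p τ) := by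
  have h2 := two_mul_exchangeTrace_le hf
  have hq : (0 : ℂ) ≤ ((1 / 4 : ℝ) : ℂ) := Complex.zero_le_real.2 (by norm_num)
  have h4 := mul_nonneg hq (sub_nonneg.2 h2)
  convert h4 using 1
  push_cast
  ring

/-- Real-part form: `0 ≤ Re (n(2 − n) − ½ Y(Γ))` on `IsDQGFeasible (n + n)`. -/
theorem spinPenalty_re_nonneg (hf : IsDQGFeasible (n + n) γ Γ) :
    0 ≤ ((n : ℂ) * (2 - (n : ℂ)) - (1 / 2 : ℂ) * ∑ σ : Fin 2, ∑ τ : Fin 2, ∑ p : Λ, ∑ q : Λ,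
      Γ (orb p σ, orb q τ) (orb q σ, orb p τ)).re :=
  (Complex.nonneg_iff.1 (spinPenalty_nonneg hf)).1

/-- The penalty has zero imaginary part on `IsDQGFeasible (n + n)` (it is a real number there). -/
theorem spinPenalty_im_eq_zero (hf : IsDQGFeasible (n + n) γ Γ) :
    ((n : ℂ) * (2 - (n : ℂ)) - (1 / 2 : ℂ) * ∑ σ : Fin 2, ∑ τ : Fin 2, ∑ p : Λ, ∑ q : Λ,
      Γ (orb p σ, orb q τ) (orb q σ, orb p τ)).im = 0 :=
  ((Complex.nonneg_iff.1 (spinPenalty_nonneg hf)).2).symm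

/-- **The penalty vanishes on the singlet-feasible set** (the row `Y = 2n(2 − n)`, rdm-A's
`exchangeTrace_of_isDQGFeasibleSinglet`). -/
theorem spinPenalty_eq_zero_of_isDQGFeasibleSinglet (hf : IsDQGFeasibleSinglet n γ Γ) :
    (n : ℂ) * (2 - (n : ℂ)) - (1 / 2 : ℂ) * ∑ σ : Fin 2, ∑ τ : Fin 2, ∑ p : Λ, ∑ q : Λ,
      Γ (orb p σ, orb q τ) (orb q σ, orb p τ) = 0 := by
  rw [exchangeTrace_of_isDQGFeasibleSinglet hf]
  ring

/-- **… and only there**: a DQG-feasible pair at `N = 2n` with vanishing penalty is singlet-feasible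
(rdm-A's `isDQGFeasibleSinglet_of_spinFreeRow`). -/
theorem isDQGFeasibleSinglet_of_spinPenalty_eq_zero (hf : IsDQGFeasible (n + n) γ Γ)
    (h0 : (n : ℂ) * (2 - (n : ℂ)) - (1 / 2 : ℂ) * ∑ σ : Fin 2, ∑ τ : Fin 2, ∑ p : Λ, ∑ q : Λ,
      Γ (orb p σ, orb q τ) (orb q σ, orb p τ) = 0) :
    IsDQGFeasibleSinglet n γ Γ :=
  isDQGFeasibleSinglet_of_spinFreeRow hf (by linear_combination (-2 : ℂ) * h0)

/-- On the singlet-feasible set the penalised functional is the unpenalised one. -/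
theorem rdmEnergy_spinPenalty_of_isDQGFeasibleSinglet (μ : ℂ) (hf : IsDQGFeasibleSinglet n γ Γ) :
    rdmEnergy h (fun p q r s => g p q r s - μ * (if q = r ∧ p = s then 1 else 0))
        (hnuc + μ * ((n : ℂ) * (2 - (n : ℂ)))) γ Γ = rdmEnergy h g hnuc γ Γ := by
  rw [rdmEnergy_spinPenalty, spinPenalty_eq_zero_of_isDQGFeasibleSinglet hf, mul_zero, add_zero]

end Penalty

/-! ### §2 The penalty IS `⟨Ŝ²⟩`: the cell's E3 row at pair level, `‖Ŝ_+ψ‖² = ⟨ψ|Ŝ²|ψ⟩` at state level -/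

section Identification

variable {n : ℕ} {γ : Matrix (Orb Λ) (Orb Λ) ℂ} {Γ : Matrix (Orb Λ × Orb Λ) (Orb Λ × Orb Λ) ℂ}

/-- **On the `(n, n)` sector programme the spin-free penalty is the cell's E3 row functional**
(the `⟨Ŝ_−Ŝ_+⟩`-form of the `G`-map, FORMAT-qcl1 §5 E3): `n(2 − n) − ½ Y(Γ) = Σ_{pq} G_{(pβ,pα),(qβ,qα)}`
(`= n − Σ_{xy} Γ_{(xα,yβ),(yα,xβ)}`, Mazziotti's row (98) functional) — block traces (89)–(90) and
antisymmetry turn the same-spin parts of `Y` into `−2n(n − 1)`. So `E_PQG(Ĥ + μŜ²; n, n)` is the value of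
the cell's `S_z`-sector DQG instance with the objective shifted by `μ ×` (its own E3 row form). -/
theorem spinPenalty_eq_sum_gMap_of_isDQGFeasibleSector (hf : IsDQGFeasibleSector n n γ Γ) :
    (n : ℂ) * (2 - (n : ℂ)) - (1 / 2 : ℂ) * ∑ σ : Fin 2, ∑ τ : Fin 2, ∑ p : Λ, ∑ q : Λ,
        Γ (orb p σ, orb q τ) (orb q σ, orb p τ) =
      ∑ p : Λ, ∑ q : Λ, gMap γ Γ (orb p 1, orb p 0) (orb q 1, orb q 0) := by
  rw [sum_gMap_downUp_of_isDQGFeasibleSector hf]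
  simp only [Fin.sum_univ_two]
  rw [sum_sum_cross_eq_neg hf.dqg.swap_snd 0 0, sum_sum_cross_eq_neg hf.dqg.swap_snd 1 1, hf.trace_upUp,
    hf.trace_downDown, sum_exchange_downUp_eq hf.dqg.swap_fst hf.dqg.swap_snd]
  ring

/-- The same in the row-(98) form: `n(2 − n) − ½ Y(Γ) = n − Σ_{xy} Γ_{(xα,yβ),(yα,xβ)}` on the `(n, n)`
sector programme. -/
theorem spinPenalty_eq_sub_exchange_of_isDQGFeasibleSector (hf : IsDQGFeasibleSector n n γ Γ) :
    (n : ℂ) * (2 - (n : ℂ)) - (1 / 2 : ℂ) * ∑ σ : Fin 2, ∑ τ : Fin 2, ∑ p : Λ, ∑ q : Λ,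
        Γ (orb p σ, orb q τ) (orb q σ, orb p τ) =
      (n : ℂ) - ∑ x : Λ, ∑ y : Λ, Γ (orb x 0, orb y 1) (orb y 0, orb x 1) := by
  rw [spinPenalty_eq_sum_gMap_of_isDQGFeasibleSector hf, sum_gMap_downUp_of_isDQGFeasibleSector hf]

/-- **At state level the penalty is `‖Ŝ_+ψ‖²`**: on the reduced density matrices of a unit vector of the
`(n, n)` sector, `n(2 − n) − ½ Y(²D_ψ) = ⟨Ŝ_+ψ, Ŝ_+ψ⟩` (`gMap_rdm`, `sum_particleHoleRDM_eq_norm_spinPlus`). -/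
theorem spinPenalty_rdm_eq_norm_sq_spinPlus {ψ : Fock (Orb Λ)} (hψ : IsInSector n n ψ)
    (hψ1 : star ψ ⬝ᵥ ψ = 1) :
    (n : ℂ) * (2 - (n : ℂ)) - (1 / 2 : ℂ) * ∑ σ : Fin 2, ∑ τ : Fin 2, ∑ p : Λ, ∑ q : Λ,
        twoRDM ψ (orb p σ, orb q τ) (orb q σ, orb p τ) =
      star (spinPlus *ᵥ ψ) ⬝ᵥ (spinPlus *ᵥ ψ) := by
  rw [spinPenalty_eq_sum_gMap_of_isDQGFeasibleSector (IsDQGFeasibleSector.of_state hψ hψ1), gMap_rdm,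
    sum_particleHoleRDM_eq_norm_spinPlus]

/-- **… `= ⟨ψ|Ŝ²|ψ⟩`**: in the balanced sector `Ŝ_z ψ = 0`, so `Ŝ²ψ = Ŝ_−Ŝ_+ψ` and the penalty of the
pair of `ψ` is the expectation of the total-spin Casimir `Ŝ²` (`spinSq`) — the operator the STRUCTURE
sentence names; the perturbed tables of §1–§3 are those of `Ĥ + μŜ²` on the `N = 2n` sector. -/
theorem spinPenalty_rdm_eq_expect_spinSq {ψ : Fock (Orb Λ)} (hψ : IsInSector n n ψ)
    (hψ1 : star ψ ⬝ᵥ ψ = 1) :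
    (n : ℂ) * (2 - (n : ℂ)) - (1 / 2 : ℂ) * ∑ σ : Fin 2, ∑ τ : Fin 2, ∑ p : Λ, ∑ q : Λ,
        twoRDM ψ (orb p σ, orb q τ) (orb q σ, orb p τ) =
      star ψ ⬝ᵥ spinSq *ᵥ ψ := by
  have hZ : HubbardWave0.spinZ *ᵥ ψ = 0 := by
    rw [LiebThm1.spinZ_mulVec_of_isInSector hψ, sub_self, mul_zero, zero_smul]
  rw [spinPenalty_rdm_eq_norm_sq_spinPlus hψ hψ1, LiebTwo.spinSq_mulVec_eq_of_spinZ_zero hZ,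
    Literature.MathematicalPhysics.QuantumLattice.spinMinus, star_mulVec, ← dotProduct_mulVec]

/-- **The penalised energy at state level**: for a unit vector `ψ` of the `(n, n)` sector,
`E_{h, g − μδ, h_nuc + μ n(2−n)}(¹D_ψ, ²D_ψ) = ⟨ψ|Ĥ(h, g, h_nuc)|ψ⟩ + μ ⟨ψ|Ŝ²|ψ⟩`. -/
theorem rdmEnergy_spinPenalty_rdm (h : Λ → Λ → ℂ) (g : Λ → Λ → Λ → Λ → ℂ) (hnuc μ : ℂ)
    {ψ : Fock (Orb Λ)} (hψ : IsInSector n n ψ) (hψ1 : star ψ ⬝ᵥ ψ = 1) :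
    rdmEnergy h (fun p q r s => g p q r s - μ * (if q = r ∧ p = s then 1 else 0))
        (hnuc + μ * ((n : ℂ) * (2 - (n : ℂ)))) (oneRDM ψ) (twoRDM ψ) =
      star ψ ⬝ᵥ molecularHamiltonian h g hnuc *ᵥ ψ + μ * (star ψ ⬝ᵥ spinSq *ᵥ ψ) := by
  rw [rdmEnergy_spinPenalty, rdmEnergy_rdm h g hnuc hψ1, spinPenalty_rdm_eq_expect_spinSq hψ hψ1]

end Identification

end Summit.Ventures.CertifiedQuantumChemistry

end
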